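import Summits.CriticalPhenomena.PercolationContinuityZ3.Theorems.PercNearOneGluingNoHeavyLowerTailMergeGainTools
import Summits.CriticalPhenomena.PercolationContinuityZ3.Theorems.PercNearOneGluingAdditiveGluingOneBond
import Literature.Probability.Percolation.KozmaNitzanSeparatingTriple
import HarnessLib

/-!
# `NoHeavyLowerTail` (stmt-CriticalPhenomena-4575) — the GOODNESS (GC) face of the two-formal-units corner of the `2+2` kernel

Support file (prover `prim-hp-2`, deletion–contraction line, gen 6; `--supports stmt-CriticalPhenomena-4575`).  No definitions,
no named facts, no sorries.  Memo: `run/shared/lean/prim/prim-hp-2/MEMO-gen6-gc-formal-corner.md`; companions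
`…TwoFormalUnits` / `…NoAllBad` (lemma factory `prim-lf-3`: the PP0 face `C₀₀ ≥ 0` of the same corner) and
`prim-nh-lead-4575/KERNEL-BETA-R-TORUS.md` (torus decomposition of the `2+2` cell into nine corners).

Setting (`Fin n`, core weights `w`, ports `p₁,p₂` (pair `e_P`) and `q₁,q₂` (pair `e_Q`), witness `j`, a vertex `r` that is `w`-below the ports
`p₁` and `q₁` (in the application `r = argmin_K`, the loneliest relay of the core), numbers `u,v ∈ [0,1]`).  Weightings as in `…TwoFormalUnits`:
`wP := w[e_P ↦ 1]`, `wQ := w[e_Q ↦ 1]`, `wPQ := w[e_P ↦ 1][e_Q ↦ 1]` (pairs glued SEPARATELY), `wM := wPQ[s(q₁,p₁) ↦ 1]` (everything MERGED);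
`(z − j)_ξ := μ_ξ(z ↔ b) − μ_ξ(j ↔ b)`, `α_P := (p₁ − j)_{wP}`, `α_Q := (q₁ − j)_{wQ}`, `δ := (p₁ − j)_{wM}`.  The GOODNESS-face corner value is

   `T := (1−u)(1−v)·(r − j)_w + u(1−v)·α_P + (1−u)v·α_Q + uv·δ`

(`= C₀₀ − (1−u)(1−v)·[μ_w(j↔b) − μ_w(r↔b)]`: the PP0 corner `C₀₀` of `…TwoFormalUnits` minus the goodness deficit of the witness; for the two-coin
one-layer observer `z` (hairs to `p₁,p₂` comonotone with probability `u`, to `q₁,q₂` comonotone with probability `v`) `T` is exactly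
`P(z ↔ b) − P(j ↔ b) + P(z isolated)·μ_w(r ↔ b)`, Kozma–Nitzan's goodness functional with witness `j` and minimum taken at `r`).

* `KNGoodFormalCorner.real_update_mix` — the mixture identity `μ_{g[e ↦ (1−t)·g e + t]}(S) = (1−t)·μ_g(S) + t·μ_{g[e↦1]}(S)` (one-bond decomposition).
* `KNGoodFormalCorner.mixGlue_le` — **Lemma 5 in the mixed graph `K + (e : t)`**: if `x` is below `c` in the mixture `(1−t)·μ_g + t·μ_{g[e↦1]}`
  then, after gluing the pair `s(c,d)` (`e ≠ s(c,d)`), `x` is below `c` in the mixture `(1−t)·μ_{g[cd↦1]} + t·μ_{g[cd↦1][e↦1]}`.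
* `KNGoodFormalCorner.gcCorner_arith` — the real-arithmetic core (dichotomy on the `K_u`-order of `r` and the port `q₁` of the lighter block).
* `KNGoodFormalCorner.twoFormalUnits_gc` — **THEOREM**: `0 ≤ T` under the split rows of `r`, `p₁`, `q₁` (the witness `j` is below each of them on
  average over the four coin outcomes, pairs glued separately) and `μ_w(r↔b) ≤ μ_w(p₁↔b)`, `μ_w(r↔b) ≤ μ_w(q₁↔b)`.
  Proof: `T − row_r = u(1−v)Φ_r(P) + (1−u)vΦ_r(Q) + uv[(L − r)_{wPQ} + g_L − g_j]` (`L` the `wPQ`-lighter block, `g` the merge gains), with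
  `Φ_r ≥ 0` (Lemma 5) and `g_L ≥ g_j` (Lemma 4, glued form (9)); if `r ≤ ℓ` (`ℓ` the row-port of `L`) in the mixed graph `K + (e_D : ·)` then
  Lemma 5 there gives `(1−·)Φ_r(L) ≥ ·((r − L)_{wPQ})` and `T ≥ row_r ≥ 0`; otherwise `T − row_ℓ = (1−·)[(r − ℓ)_{K+(e_D:·)} + ·Φ_r(D)] + ··(g_L − g_j) ≥ 0`.
-/

namespace Summit.CriticalPhenomena.PercolationContinuityZ3.Theorems

open MeasureTheory Set ProbabilityTheory
open Literature.Probability.LatticeModels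
open Literature.Probability.Percolation

noncomputable section
open Classical

namespace KNGoodFormalCorner

open UpsetExchange

variable {n : ℕ}

/-- The convex combination `(1−t)·a + t` of `a ∈ [0,1]` and `1`, as a point of `[0,1]`. [folklore] -/
theorem mix_mem_unitInterval {a t : ℝ} (ha0 : 0 ≤ a) (ha1 : a ≤ 1) (ht0 : 0 ≤ t) (ht1 : t ≤ 1) :
    (1 - t) * a + t ∈ unitInterval := by
  constructor
  · nlinarith
  · nlinarith

/-- **Mixture identity** (one-bond decomposition): with `τ := (1−t)·(g e) + t`,
`μ_{g[e↦τ]}(S) = (1−t)·μ_g(S) + t·μ_{g[e↦1]}(S)` — the graph `G + (e : t)` (an extra copy of the pair `e` with weight `t`) realised as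
a single weight. [folklore] -/
theorem real_update_mix (g : Sym2 (Fin n) → unitInterval) (e : Sym2 (Fin n)) {t : ℝ} (ht0 : 0 ≤ t) (ht1 : t ≤ 1)
    (S : Set (BondConfig (Fin n))) :
    (prodBernoulli (Function.update g e ⟨(1 - t) * (g e : ℝ) + t,
        mix_mem_unitInterval (g e).2.1 (g e).2.2 ht0 ht1⟩)).real S =
      (1 - t) * (prodBernoulli g).real S + t * (prodBernoulli (Function.update g e 1)).real S := by
  set τ : unitInterval := ⟨(1 - t) * (g e : ℝ) + t, mix_mem_unitInterval (g e).2.1 (g e).2.2 ht0 ht1⟩ with hτ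
  have h1 := stub_oneBondDecomp_k15 n (Function.update g e τ) e S
  rw [Function.update_idem, Function.update_idem, Function.update_self] at h1
  have h2 := stub_oneBondDecomp_k15 n g e S
  have h3 := stub_oneBondDecomp_k15 n (Function.update g e 1) e S
  rw [Function.update_idem, Function.update_idem, Function.update_self] at h3
  have hτv : ((τ : unitInterval) : ℝ) = (1 - t) * (g e : ℝ) + t := rfl
  rw [h1, h2, h3, hτv]
  simp only [Set.Icc.coe_one]
  ring

/-- **Lemma 5 in the mixed graph `K + (e : t)`.**  `gE := g[e↦1]`, `gC := g[s(c,d)↦1]`, `gCE := gC[e↦1]`, `e ≠ s(c,d)`.  If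
`(1−t)μ_g(x↔b) + tμ_{gE}(x↔b) ≤ (1−t)μ_g(c↔b) + tμ_{gE}(c↔b)` then `(1−t)μ_{gC}(x↔b) + tμ_{gCE}(x↔b) ≤ (1−t)μ_{gC}(c↔b) + tμ_{gCE}(c↔b)`.
(Kozma–Nitzan's Lemma 5 applied in the ordinary graph in which the pair `e` carries an additional independent copy of weight `t`.)
[cite: KozmaNitzan2024, Lemma 5 (p. 13); VandenbergHaggstromKahn2005, Thm. 1.2] -/
theorem mixGlue_le (g : Sym2 (Fin n) → unitInterval) {c d : Fin n} (hcd : c ≠ d) (e : Sym2 (Fin n)) (he : e ≠ s(c, d))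
    (x b : Fin n) {t : ℝ} (ht0 : 0 ≤ t) (ht1 : t ≤ 1)
    (hle : (1 - t) * (prodBernoulli g).real (openConn x b) +
        t * (prodBernoulli (fun f : Sym2 (Fin n) => if f = e then 1 else g f)).real (openConn x b) ≤
      (1 - t) * (prodBernoulli g).real (openConn c b) +
        t * (prodBernoulli (fun f : Sym2 (Fin n) => if f = e then 1 else g f)).real (openConn c b)) :
    (1 - t) * (prodBernoulli (fun f : Sym2 (Fin n) => if f = s(c, d) then 1 else g f)).real (openConn x b) +
        t * (prodBernoulli (fun f : Sym2 (Fin n) => if f = e then 1 else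
              if f = s(c, d) then 1 else g f)).real (openConn x b) ≤
      (1 - t) * (prodBernoulli (fun f : Sym2 (Fin n) => if f = s(c, d) then 1 else g f)).real (openConn c b) +
        t * (prodBernoulli (fun f : Sym2 (Fin n) => if f = e then 1 else
              if f = s(c, d) then 1 else g f)).real (openConn c b) := by
  set gC : Sym2 (Fin n) → unitInterval := fun f => if f = s(c, d) then 1 else g f with hgC
  have hE : (fun f : Sym2 (Fin n) => if f = e then (1 : unitInterval) else g f) = Function.update g e 1 := by
    funext f; rw [Function.update_apply]
  have hCE : (fun f : Sym2 (Fin n) => if f = e then (1 : unitInterval) else if f = s(c, d) then 1 else g f) =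
      Function.update gC e 1 := by
    funext f; rw [Function.update_apply]
  rw [hE] at hle
  rw [hCE]
  -- the mixed weight on `e`
  set τ : unitInterval := ⟨(1 - t) * (g e : ℝ) + t, mix_mem_unitInterval (g e).2.1 (g e).2.2 ht0 ht1⟩ with hτ
  have hgCe : gC e = g e := by simp only [hgC, if_neg he]
  have hτ' : (⟨(1 - t) * (gC e : ℝ) + t, mix_mem_unitInterval (gC e).2.1 (gC e).2.2 ht0 ht1⟩ : unitInterval) = τ := by
    apply Subtype.ext; simp only [hgCe, hτ]
  -- Lemma 5 in the graph with `e ↦ τ`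
  have hmix := fun S => real_update_mix g e ht0 ht1 S
  have hle' : (prodBernoulli (Function.update g e τ)).real (openConn x b) ≤
      (prodBernoulli (Function.update g e τ)).real (openConn c b) := by
    rw [hmix, hmix]; exact hle
  have h5 := pairGlue_le (Function.update g e τ) hcd x b hle'
  -- the glued weighting is `gC[e ↦ τ]`
  have hglue : (fun f : Sym2 (Fin n) => if f = s(c, d) then (1 : unitInterval) else Function.update g e τ f) =
      Function.update gC e ⟨(1 - t) * (gC e : ℝ) + t, mix_mem_unitInterval (gC e).2.1 (gC e).2.2 ht0 ht1⟩ := by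
    rw [hτ']
    funext f
    by_cases hf : f = e
    · subst hf
      rw [if_neg he, Function.update_self, Function.update_self]
    · rw [Function.update_of_ne hf, Function.update_of_ne hf]
  rw [hglue] at h5
  have hmixC := fun S => real_update_mix gC e ht0 ht1 S
  rw [hmixC, hmixC] at h5
  exact h5

/-- **Arithmetic core** of the goodness-face corner: the dichotomy on the mixed-graph order of `r` and the row-port `q` of the lighter block.
Inputs are real numbers (reliabilities in `w`, `wP`, `wQ`, `wPQ`, `wM`); see `twoFormalUnits_gc` for their meaning. [folklore] -/
theorem gcCorner_arith {u v ρr ρj ρq Pr Pj Pp Pq Qr Qj Qq Sr Sj Sq M Mj : ℝ}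
    (hu0 : 0 ≤ u) (hv0 : 0 ≤ v) (hv1 : v ≤ 1)
    (hrowr : 0 ≤ (1 - u) * (1 - v) * (ρr - ρj) + u * (1 - v) * (Pr - Pj) + (1 - u) * v * (Qr - Qj) + u * v * (Sr - Sj))
    (hrowq : 0 ≤ (1 - u) * (1 - v) * (ρq - ρj) + u * (1 - v) * (Pq - Pj) + (1 - u) * v * (Qq - Qj) + u * v * (Sq - Sj))
    (hF1 : Pr ≤ Pp) (hF3 : Sq - Sj ≤ M - Mj)
    (hA : (1 - u) * ρr + u * Pr ≤ (1 - u) * ρq + u * Pq → (1 - u) * Qr + u * Sr ≤ (1 - u) * Qq + u * Sq) :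
    0 ≤ (1 - u) * (1 - v) * (ρr - ρj) + u * (1 - v) * (Pp - Pj) + (1 - u) * v * (Qq - Qj) + u * v * (M - Mj) := by
  have huv : 0 ≤ u * v := mul_nonneg hu0 hv0
  have hu1v : 0 ≤ u * (1 - v) := mul_nonneg hu0 (by linarith)
  have h3 : u * v * (Sq - Sj) ≤ u * v * (M - Mj) := mul_le_mul_of_nonneg_left hF3 huv
  have h1 : u * (1 - v) * Pr ≤ u * (1 - v) * Pp := mul_le_mul_of_nonneg_left hF1 hu1v
  by_cases hc : (1 - u) * ρr + u * Pr ≤ (1 - u) * ρq + u * Pq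
  · -- case A: `T ≥ row_r`
    have hA' := hA hc
    have h2 : v * ((1 - u) * Qr + u * Sr) ≤ v * ((1 - u) * Qq + u * Sq) := mul_le_mul_of_nonneg_left hA' hv0
    nlinarith [hrowr, h1, h2, h3]
  · -- case B: `T ≥ row_q`
    have hc' : (1 - u) * ρq + u * Pq ≤ (1 - u) * ρr + u * Pr := le_of_lt (not_le.mp hc)
    have h2 : (1 - v) * ((1 - u) * ρq + u * Pq) ≤ (1 - v) * ((1 - u) * ρr + u * Pr) :=
      mul_le_mul_of_nonneg_left hc' (by linarith)
    nlinarith [hrowq, h1, h2, h3]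

/-- **The goodness face of the two-formal-units corner (`C₀₀^{GC} ≥ 0`).**  See the module docstring for the notation.
Hypotheses: `u, v ∈ [0,1]`; `p₁ ≠ p₂`, `q₁ ≠ q₂`, `p₁ ≠ q₁`, `e_P ≠ e_Q`; `μ_w(r↔b) ≤ μ_w(p₁↔b)` and `μ_w(r↔b) ≤ μ_w(q₁↔b)` (e.g. `r` the
`w`-loneliest relay); the split rows of `r`, `p₁`, `q₁`:
`0 ≤ (1−u)(1−v)(z − j)_w + u(1−v)(z − j)_{wP} + (1−u)v(z − j)_{wQ} + uv(z − j)_{wPQ}` for `z ∈ {r, p₁, q₁}`.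
Conclusion: `0 ≤ (1−u)(1−v)(r − j)_w + u(1−v)(p₁ − j)_{wP} + (1−u)v(q₁ − j)_{wQ} + uv(p₁ − j)_{wM}`.
[cite: KozmaNitzan2024, Lemma 4 & eq. (9), Lemma 5, §3.2 (pp. 9–10, 13); VandenbergHaggstromKahn2005, Thm. 1.2] -/
theorem twoFormalUnits_gc (w : Sym2 (Fin n) → unitInterval) (p₁ p₂ q₁ q₂ j r b : Fin n)
    (hp : p₁ ≠ p₂) (hq : q₁ ≠ q₂) (hpq : p₁ ≠ q₁) (hPQ : s(p₁, p₂) ≠ s(q₁, q₂))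
    {u v : ℝ} (hu0 : 0 ≤ u) (hu1 : u ≤ 1) (hv0 : 0 ≤ v) (hv1 : v ≤ 1)
    (hrP : (prodBernoulli w).real (openConn r b) ≤ (prodBernoulli w).real (openConn p₁ b))
    (hrQ : (prodBernoulli w).real (openConn r b) ≤ (prodBernoulli w).real (openConn q₁ b))
    (hrow : ∀ z ∈ ({r, p₁, q₁} : Finset (Fin n)), 0 ≤
      (1 - u) * (1 - v) * ((prodBernoulli w).real (openConn z b) - (prodBernoulli w).real (openConn j b)) +
      u * (1 - v) * ((prodBernoulli (fun f : Sym2 (Fin n) => if f = s(p₁, p₂) then 1 else w f)).real (openConn z b) -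
        (prodBernoulli (fun f : Sym2 (Fin n) => if f = s(p₁, p₂) then 1 else w f)).real (openConn j b)) +
      (1 - u) * v * ((prodBernoulli (fun f : Sym2 (Fin n) => if f = s(q₁, q₂) then 1 else w f)).real (openConn z b) -
        (prodBernoulli (fun f : Sym2 (Fin n) => if f = s(q₁, q₂) then 1 else w f)).real (openConn j b)) +
      u * v * ((prodBernoulli (fun f : Sym2 (Fin n) => if f = s(p₁, p₂) then 1 else if f = s(q₁, q₂) then 1 else w f)).real (openConn z b) -
        (prodBernoulli (fun f : Sym2 (Fin n) => if f = s(p₁, p₂) then 1 else if f = s(q₁, q₂) then 1 else w f)).real (openConn j b))) :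
    0 ≤ (1 - u) * (1 - v) * ((prodBernoulli w).real (openConn r b) - (prodBernoulli w).real (openConn j b)) +
      u * (1 - v) * ((prodBernoulli (fun f : Sym2 (Fin n) => if f = s(p₁, p₂) then 1 else w f)).real (openConn p₁ b) -
          (prodBernoulli (fun f : Sym2 (Fin n) => if f = s(p₁, p₂) then 1 else w f)).real (openConn j b)) +
      (1 - u) * v * ((prodBernoulli (fun f : Sym2 (Fin n) => if f = s(q₁, q₂) then 1 else w f)).real (openConn q₁ b) -
          (prodBernoulli (fun f : Sym2 (Fin n) => if f = s(q₁, q₂) then 1 else w f)).real (openConn j b)) +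
      u * v * ((prodBernoulli (fun f : Sym2 (Fin n) => if f = s(q₁, p₁) then 1 else
                  if f = s(p₁, p₂) then 1 else if f = s(q₁, q₂) then 1 else w f)).real (openConn p₁ b) -
          (prodBernoulli (fun f : Sym2 (Fin n) => if f = s(q₁, p₁) then 1 else
                  if f = s(p₁, p₂) then 1 else if f = s(q₁, q₂) then 1 else w f)).real (openConn j b)) := by
  -- weightings
  set wP : Sym2 (Fin n) → unitInterval := fun f => if f = s(p₁, p₂) then 1 else w f with hwP
  set wQ : Sym2 (Fin n) → unitInterval := fun f => if f = s(q₁, q₂) then 1 else w f with hwQ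
  set wPQ : Sym2 (Fin n) → unitInterval := fun f => if f = s(p₁, p₂) then 1 else if f = s(q₁, q₂) then 1 else w f with hwPQ
  set wM : Sym2 (Fin n) → unitInterval := fun f => if f = s(q₁, p₁) then 1 else
    if f = s(p₁, p₂) then 1 else if f = s(q₁, q₂) then 1 else w f with hwM
  have hwPQ' : wPQ = fun f => if f = s(p₁, p₂) then 1 else wQ f := by funext f; simp only [hwPQ, hwQ]
  have hwQP : (fun f : Sym2 (Fin n) => if f = s(q₁, q₂) then (1 : unitInterval) else
      if f = s(p₁, p₂) then 1 else w f) = wPQ := by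
    funext f
    simp only [hwPQ]
    by_cases h1 : f = s(q₁, q₂)
    · rw [if_pos h1]
      by_cases h2 : f = s(p₁, p₂)
      · rw [if_pos h2]
      · rw [if_neg h2, if_pos h1]
    · rw [if_neg h1]
      by_cases h2 : f = s(p₁, p₂)
      · rw [if_pos h2, if_pos h2]
      · rw [if_neg h2, if_neg h2, if_neg h1]
  have hwM' : wM = fun f => if f = s(q₁, p₁) then 1 else wPQ f := by funext f; simp only [hwM, hwPQ]
  have hwMupd : Function.update wPQ s(q₁, p₁) 1 = wM := by
    rw [hwM']; funext f; rw [Function.update_apply]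
  -- representatives of glued pairs
  have hrepM : (prodBernoulli wM).real (openConn q₁ b) = (prodBernoulli wM).real (openConn p₁ b) := by
    have h := real_openConn_pair_eq wPQ (Ne.symm hpq) b; rw [hwM']; rw [h.1, h.2]
  -- the rows
  have hr0 := hrow r (by simp)
  have hrp := hrow p₁ (by simp)
  have hrq := hrow q₁ (by simp)
  -- (F1), (F2): Lemma 5 for the pairs `e_P`, `e_Q` with the lonely vertex `r`
  have hF1 : (prodBernoulli wP).real (openConn r b) ≤ (prodBernoulli wP).real (openConn p₁ b) := pairGlue_le w hp r b hrP
  have hF2 : (prodBernoulli wQ).real (openConn r b) ≤ (prodBernoulli wQ).real (openConn q₁ b) := pairGlue_le w hq r b hrQ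
  -- (F3): Lemma 4 in the glued form (9), base `wPQ`, pair `s(q₁,p₁)`, third party `j`
  have hL4 := KozmaNitzan2024_lemma4_glued wPQ q₁ p₁ j b
  rw [hwMupd, hrepM] at hL4
  -- abbreviations
  set ρr : ℝ := (prodBernoulli w).real (openConn r b) with hρr
  set ρj : ℝ := (prodBernoulli w).real (openConn j b) with hρj
  set ρp : ℝ := (prodBernoulli w).real (openConn p₁ b) with hρp
  set ρq : ℝ := (prodBernoulli w).real (openConn q₁ b) with hρq
  set Pr : ℝ := (prodBernoulli wP).real (openConn r b) with hPr
  set Pj : ℝ := (prodBernoulli wP).real (openConn j b) with hPj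
  set Pp : ℝ := (prodBernoulli wP).real (openConn p₁ b) with hPp
  set Pq : ℝ := (prodBernoulli wP).real (openConn q₁ b) with hPq
  set Qr : ℝ := (prodBernoulli wQ).real (openConn r b) with hQr
  set Qj : ℝ := (prodBernoulli wQ).real (openConn j b) with hQj
  set Qq : ℝ := (prodBernoulli wQ).real (openConn q₁ b) with hQq
  set Qp : ℝ := (prodBernoulli wQ).real (openConn p₁ b) with hQp
  set Sr : ℝ := (prodBernoulli wPQ).real (openConn r b) with hSr
  set Sj : ℝ := (prodBernoulli wPQ).real (openConn j b) with hSj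
  set Sp : ℝ := (prodBernoulli wPQ).real (openConn p₁ b) with hSp
  set Sq : ℝ := (prodBernoulli wPQ).real (openConn q₁ b) with hSq
  set M : ℝ := (prodBernoulli wM).real (openConn p₁ b) with hM
  set Mj : ℝ := (prodBernoulli wM).real (openConn j b) with hMj
  -- which block is lighter after the separate gluings
  rcases le_total Sq Sp with hQlight | hPlight
  · -- `Q` is the lighter block: `g_Q ≥ g_j`, dichotomy on the order of `r`, `q₁` in `K + (e_P : u)`
    have hF3 : Sq - Sj ≤ M - Mj := le_trans (by rw [min_eq_left (by linarith)]) hL4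
    have hA : (1 - u) * ρr + u * Pr ≤ (1 - u) * ρq + u * Pq → (1 - u) * Qr + u * Sr ≤ (1 - u) * Qq + u * Sq := by
      intro h
      exact mixGlue_le w hq (s(p₁, p₂)) hPQ r b hu0 hu1 h
    exact gcCorner_arith hu0 hv0 hv1 hr0 hrq hF1 hF3 hA
  · -- `P` is the lighter block: the same with the roles of the two pairs (and of `u`, `v`) exchanged
    have hF3 : Sp - Sj ≤ M - Mj := le_trans (by rw [min_eq_right (by linarith)]) hL4
    have hA : (1 - v) * ρr + v * Qr ≤ (1 - v) * ρp + v * Qp → (1 - v) * Pr + v * Sr ≤ (1 - v) * Pp + v * Sp := by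
      intro h
      have hx := mixGlue_le w hp (s(q₁, q₂)) (Ne.symm hPQ) r b hv0 hv1 h
      rw [hwQP] at hx
      exact hx
    have hrp' : 0 ≤ (1 - v) * (1 - u) * (ρp - ρj) + v * (1 - u) * (Qp - Qj) + (1 - v) * u * (Pp - Pj) + v * u * (Sp - Sj) := by
      linarith [hrp]
    have hr0' : 0 ≤ (1 - v) * (1 - u) * (ρr - ρj) + v * (1 - u) * (Qr - Qj) + (1 - v) * u * (Pr - Pj) + v * u * (Sr - Sj) := by
      linarith [hr0]
    have key := gcCorner_arith hv0 hu0 hu1 hr0' hrp' hF2 hF3 hA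
    linarith [key]

end KNGoodFormalCorner

end

end Summit.CriticalPhenomena.PercolationContinuityZ3.Theorems
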